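import Summits.HubbardSuperconductivity.HubbardLadder.HubbardDopedAFWindowGlue
import HarnessLib

/-!
# R2 rows (device D27): the doped staggered structure factor `S(π,π)` window on the `4 × 4` torus
# (`U = 8`, `t' = 0`, `N = 14`) from the two `secrows1` SECTOR-mode observable certificates, with the
# `S^z`-resolution glue that turns a sector-mode claim into a row for EVERY ground state

HONEST FRAMING (page 1): ladder R1–R4 with certified numbers; no claim on H/H₀.

FILE SPLIT (filer's note): §1 (the `S^z`-resolution glue) and §2 (the generic `N = 14` sector-certificate edges)
live in part 1, `Summits.HubbardSuperconductivity.HubbardLadder.HubbardDopedAFWindowGlue`, imported here — the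
gate caps `Summits/` files at 400 lines; every declaration of both parts is byte-identical to the staged single
file (sha256 `2c4d8a1bb11606f5…`); this part holds §3 (the two claim nodes and the rows).

OBJECT. Normalised ground states `ψ` of the doped pure Hubbard model `hamiltonian (fermionTorusGraph 2 4) 1 8`
on the `4 × 4` torus in the `N = 14` sector (`n = 7/8`, `t' = 0`), and the staggered spin structure operator
`𝓢 = Σ_{x,y} (-1)^{x₁+x₂+y₁+y₂} 𝐒_x·𝐒_y` (`stagStructureFour`; `x = y` included; `𝐒_x = ½ c†_x σ c_x`,
`𝐒_x·𝐒_y = ½ (S⁺_x S⁻_y + S⁻_x S⁺_y) + S^z_x S^z_y`), so that `S(π,π) = ⟨𝓢⟩/16` per site and the squared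
staggered magnetisation is `m_s² = ⟨𝓢⟩/256` (R2-TABLE §C / OBSERVABLES §3). Before this file the only `N = 14`
row on `𝓢` was the certificate-free ceiling `m_s² ≤ 35/128` (`stagMagSq_four_N14_le`) and the floor `0`.

THE TWO CERTIFICATES (cell pub-hubbard, producer eng-1, named campaign `secrows1`, engines R-254(d); files
`certs/secrows1/N14.AFlo/cert_hub_torus4x4_U8_N14_b4eom_AFlo.json.gz` (file sha256 `cb11dcb0a099…`, canonical
`75f4c2af46bb9978…`, kit j101608) and `certs/secrows1/N14.AFup/cert_hub_torus4x4_U8_N14_b4eom_AFup.json.gz` (file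
sha256 `ef147690…`, canonical `d4fa163ec7b6023b…`, kit j101609); format certsdp/1, `hypotheses.mode = sector`
(ideal `N̂ − 14` only), `objective = total_plus` with `objective_h0_coeff = 0` and `objective_extra = {spin_stag: ±1}`,
i.e. objective `±V`, `V = Σ_{x,y} ε_x ε_y 𝐒_x·𝐒_y = 𝓢` verbatim (engines `certsdp/models.py` `spin_stag`: "ALL
ordered pairs incl. x = y; ε_x = (−1)^{sum of coordinates}; S.S = (S+S- + S-S+)/2 + Sz Sz, S+ = c*_up c_dn,
Sz = (n_up - n_dn)/2" = `fermionSpinDot`), ONE `energy_upper` inequality row `ω(H) ≤ u` with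
`u = model.energy_upper.value = −815606355579/2³⁶` VERBATIM = the in-tree INHERITED node
`Bounds.torusUpper_mbbootE2_4x4_U8_N14`, degree 2 + bond clusters 4 + eom 4). THE claims (`claimed.E_cert`, the
sector constant = the proved constant of FORMAT-certsdp1 §3): `⟨V⟩ ≥ 4037843807093362474310869/2⁸⁰ = 3.3400261…`
(AFlo) and `⟨−V⟩ ≥ −58983938970897400422364577/2⁸⁰`, i.e. `⟨V⟩ ≤ 48.7903707…` (AFup), for every state of the
sector class. READERS OF RECORD (eng-1 dated line 2026-08-20T19:56:48Z): reader B `certsdp.verify_b 0.5.4rc1`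
ACCEPT ok∧equal 13/13 on both files with `E_recomputed = claimed.E_cert` EXACTLY; reader A `certsdp.verify_a 0.3.3
('1.2.3')` ok∧equal 12/12 on both, comparing (its documented rule for lower_factor torus files) with the REDUCE-mode
twin `claimed.also.E_cert` (AFlo `4037843869719080211814803/2⁸⁰`, AFup `−58983938834811007330006663/2⁸⁰`; ΔE ≤
1.2e−7 total, same outward 7-dp edges). LEAD LABEL (2026-08-20T20:00:06Z): "CELL sector-SDP window, 4×4 torus,
WEAK; reader B exact on the sector claim; reader A exact on the reduce twin; PD same e1-generator lineage; UNSIGNED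
until ref-secrows1-replay". This file types THE (sector, assumption-free) claims; every number below derives
from `claimed.E_cert`, never from the float optimum (`E_sdp`, NON-RIGOROUS, orientation only).

HOW A CERTIFICATE ENTERS THE TREE (r3's convention, `PairCorrSectorCert` §2): as a CLAIM NODE
`Nonempty (TorusSectorObsCertTT' 4 1 0 8 14 M u X q)` — the certificate DATA type of a certsdp/1 §9 sector file
for the `t–t'` torus Hamiltonian `hubbardTorusTT' 4 1 0 8 = hamiltonian (fermionTorusGraph 2 4) 1 8`
(`hubbardTorusTT'_zero`) — whose evidence is the reader-passed file. The file's identity does not mention `S^z`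
(no `S^z` ideal family: `sz_ideal = False`), so the same data inhabit the type at EVERY `M`; the nodes below are
stated `∀ M`. They are `@[conjecture] def`s: HYPOTHESES of every row, exactly like the INHERITED energy nodes of
`Bounds.TorusDopedN14Rows`; nothing is asserted.

THE GLUE (§1, generic over a finite ordered lattice `Λ`, PROVED): a sector-mode certificate bounds `Re ⟨φ, X φ⟩`
only for joint `(N, S^z)`-eigen eigenvectors `φ` (`TorusSectorObsCertTT'.re_expect_ge_of_eigenvector`). At
`N = 14` no theorem fixes the ground-state spin, so a ground state need not be `S^z`-eigen. But if `H` and `X`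
both preserve the `(N↑, N↓)` sectors (`PreservesSectors`; true for the Hubbard Hamiltonian and for every
`𝐒_x·𝐒_y`, hence for `𝓢` and for `Σ_x n_{x↑} n_{x↓}`), then for an `N`-particle `H`-eigenvector `ψ` with
eigenvalue `E` the sector components `ψ_a = sectorProj a (N − a) ψ` are `H`-eigenvectors with the same `E` lying
in `szSector N ((2a − N)/2)`, `⟨ψ, X ψ⟩ = Σ_a ⟨ψ_a, X ψ_a⟩` and `Σ_a ‖ψ_a‖² = ‖ψ‖²`; so a bound `q ≤ Re ⟨φ, X φ⟩`
valid for every unit joint-sector eigenvector `φ` with eigenvalue `E` holds for `ψ` itself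
(`re_expect_ge_of_forall_szSector`). This is Lieb's "S^z is conserved" bookkeeping (PRL 62 (1989) 1201, proof
of Thm 1), nothing more; it is what lets a §9 sector certificate serve the cell's row convention
"`∀ ψ, IsGroundState H 14 ψ → …`" (D21–D26).

ROWS (§3; hypotheses BY NAME: `h₈ : torusUpper_mbbootE2_4x4_U8_N14`, `hlo : secrowsAFlo_engA_4x4_U8_N14`,
`hup : secrowsAFup_engA_4x4_U8_N14`; every normalised `ψ` with `IsGroundState (hamiltonian (fermionTorusGraph 2 4) 1 8) 14 ψ`):
* `re_expect_stagStructureFour_N14_U8_mem_Icc_of_claims`: `⟨𝓢⟩ ∈ [4037843807093362474310869/2⁸⁰,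
  58983938970897400422364577/2⁸⁰]` (exact);
* `stagStructureFactor_four_N14_U8_mem_Icc_of_claims`: `S(π,π) = ⟨𝓢⟩/16 ∈ [0.2087516, 3.0493982]` (outward 7 dp;
  the lead's displayed edges);
* `stagMagSq_four_N14_U8_mem_Icc_of_claims`: `m_s² = ⟨𝓢⟩/256 ∈ [0.0130469, 0.1905874]` (outward 7 dp; replaces
  the certificate-free `[0, 35/128]`);
* `offsiteStagCorr_four_N14_U8_mem_Icc_of_claims`: the OFF-SITE staggered correlation sum
  `Σ_{x ≠ y} ε_x ε_y ⟨𝐒_x·𝐒_y⟩/16 = (⟨𝓢⟩ − ¾ ⟨M⟩)/16 ∈ [−0.4474984, 2.5044482]` (with `𝐒_x·𝐒_x = ¾ m_x`,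
  `⟨M⟩ = 14 − 2⟨D⟩` and the D21 row `d ∈ [0, 0.0742]`, hypothesis `h₄ : torusLower_mbboot_4x4_U4_N14` added).
§2 also states the GENERIC `N = 14`, `U = 8`, `t' = 0` edges `re_expect_ge/le_of_sectorObsCerts_four_N14_U8`
(any sector-preserving objective `X`, any value `q`) and their instance for the double occupancy
`D = Σ_x n_{x↑} n_{x↓}` (`doubleOcc_four_N14_U8_ge/le_of_sectorObsCerts`: `q/16 ≤ d`, `d ≤ −q/16`) — the typed
shape awaiting the `secrows1` D pair (kit j105793/j105797, submitted 2026-08-20T19:57Z; no number here).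

LABEL of every numeric row: CELL sector-SDP window, `4 × 4` torus, WEAK (`4 × 4` is ED-able); typed CLAIMS,
UNSIGNED until 'ref-secrows1-replay' + the cell lead's booking; energy hypothesis INHERITED (E2 Lanczos node,
not referee-replayed). 0 core-h (kernel only).

## References
* J. Wang et al., *Certifying ground-state properties of many-body systems*, PRX 14 (2024) 031006, §3
  eq. (obsopt). [cite: WangEtAl2024, §3 eq. (obsopt)]
* X. Han, *Quantum many-body bootstrap*, arXiv:2006.06002 (2020), §2 eq. (2)–(4). [cite: Han2020Bootstrap, §2 eq. (2)–(4)]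
* I. Kull, N. Schuch, B. Dive, M. Navascués, PRX 14 (2024) 021008, §5.3 (rounded certificates). [cite: KullEtAl2024, §5.3]
* E. H. Lieb, PRL 62 (1989) 1201, proof of Thm 1 (`S^z` sectors). [cite: LiebPRL1989, proof of Theorem 1]
* J. E. Hirsch, PRB 31 (1985) 4403, eq. (4.7) and Table II (`S(π,π)`, local moment on `4 × 4`). [cite: HirschPRB1985, eq. (4.7)]
* H. Tasaki, *Physics and Mathematics of Quantum Many-Body Systems* (2020), §2.1, App. A.3. [cite: Tasaki2020, §2.1]
* Cell documents: `certs/secrows1/README.md`, `certs/secrows1/N14.AF{lo,up}/README.md` (reader verdicts),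
  `pub-mbboot/certs/FORMAT-certsdp1.md` §3/§7/§9, `pub-hubbard-r2/INTERFACE-R2.md` §A3, LADDER.md (D27).
-/

noncomputable section

namespace Summit.HubbardSuperconductivity.HubbardLadder

open Matrix Literature.MathematicalPhysics.QuantumLattice Literature.Probability.LatticeModels
open Finset hiding expect
open FermionSpinMoment Bounds
open scoped ComplexOrder

section FourByFour

/-! ## §3 The two `secrows1` AF claim nodes and the `S(π,π)` / `m_s²` rows -/

/-- **CLAIM NODE `N14.AFlo`** (cell pub-hubbard, eng-1 kit j101608 `engA-secrows1-N14.AFlo`; file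
`certs/secrows1/N14.AFlo/cert_hub_torus4x4_U8_N14_b4eom_AFlo.json.gz`, sha256 `cb11dcb0a09923564781e4dc4aa094bc
3908997c404506b1cc48445ba2a723bb`, canonical `75f4c2af46bb9978f2f62d5d6dbc1a52653d68b78e11aaacfea1f39fbf18d7cd`;
certsdp/1, sector mode, ideal `N̂ − 14`, objective `+V = 𝓢` (`spin_stag: 1`, `objective_h0_coeff = 0`), one
`energy_upper` row with `u = −815606355579/2³⁶`; `claimed.E_cert = 4037843807093362474310869/2⁸⁰ = 3.3400261137…`;
reader B `verify_b 0.5.4rc1` ACCEPT ok∧equal 13/13 with `E_recomputed = claimed.E_cert` exactly (2026-08-20T18:18Z);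
reader A `verify_a 0.3.3` ok∧equal 12/12 on the reduce twin `claimed.also.E_cert = 4037843869719080211814803/2⁸⁰`
(2026-08-20T19:5xZ)): for every `M`, a sector-mode certificate for `𝓢` with value `claimed.E_cert`. TYPED CLAIM,
UNSIGNED until 'ref-secrows1-replay'; WEAK (`4 × 4` is ED-able). HONEST FRAMING: ladder R1–R4 with certified
numbers; no claim on H/H₀. [cite: WangEtAl2024, §3 eq. (obsopt)] -/
@[conjecture] def secrowsAFlo_engA_4x4_U8_N14 : Prop :=
  ∀ M : ℝ, Nonempty (TorusSectorObsCertTT' 4 1 0 8 14 M ((-815606355579 : ℝ) / 2 ^ 36) stagStructureFour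
    (4037843807093362474310869 / 2 ^ 80))

/-- **CLAIM NODE `N14.AFup`** (eng-1 kit j101609 `engA-secrows1-N14.AFup`; file
`certs/secrows1/N14.AFup/cert_hub_torus4x4_U8_N14_b4eom_AFup.json.gz`, sha256 `ef147690…`, canonical
`d4fa163ec7b6023b…`; as `N14.AFlo` but objective `−V = −𝓢` (`spin_stag: −1`);
`claimed.E_cert = −58983938970897400422364577/2⁸⁰ = −48.7903707…`; reader B ACCEPT ok∧equal 13/13 with
`E_recomputed = claimed.E_cert` exactly (2026-08-20T18:11Z); reader A ok∧equal 12/12 on the reduce twin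
`claimed.also.E_cert = −58983938834811007330006663/2⁸⁰`): for every `M`, a sector-mode certificate for `−𝓢` with
value `claimed.E_cert`. TYPED CLAIM, UNSIGNED until 'ref-secrows1-replay'; WEAK. HONEST FRAMING: ladder R1–R4
with certified numbers; no claim on H/H₀. [cite: WangEtAl2024, §3 eq. (obsopt)] -/
@[conjecture] def secrowsAFup_engA_4x4_U8_N14 : Prop :=
  ∀ M : ℝ, Nonempty (TorusSectorObsCertTT' 4 1 0 8 14 M ((-815606355579 : ℝ) / 2 ^ 36) (-stagStructureFour)
    (-58983938970897400422364577 / 2 ^ 80))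

/-- **R2 row C1AF (exact form)**: `⟨𝓢⟩ ∈ [4037843807093362474310869/2⁸⁰, 58983938970897400422364577/2⁸⁰]`
for every normalised `N = 14` ground state of the `4 × 4`, `U = 8`, `t' = 0` torus. TYPED CLAIMS, UNSIGNED;
WEAK. HONEST FRAMING: ladder R1–R4 with certified numbers; no claim on H/H₀. [cite: WangEtAl2024, §3 eq. (obsopt)] -/
theorem re_expect_stagStructureFour_N14_U8_mem_Icc_of_claims {ψ : Fock (Orb (FermionTorus 2 4))}
    (hψ : IsGroundState (hamiltonian (fermionTorusGraph 2 4) 1 8) 14 ψ) (hψ1 : star ψ ⬝ᵥ ψ = 1)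
    (h₈ : torusUpper_mbbootE2_4x4_U8_N14) (hlo : secrowsAFlo_engA_4x4_U8_N14)
    (hup : secrowsAFup_engA_4x4_U8_N14) :
    (expect stagStructureFour ψ).re ∈
      Set.Icc ((4037843807093362474310869 : ℝ) / 2 ^ 80) (58983938970897400422364577 / 2 ^ 80) := by
  refine ⟨re_expect_ge_of_sectorObsCerts_four_N14_U8 preservesSectors_stagStructureFour hlo hψ hψ1 h₈, ?_⟩
  have h := re_expect_le_of_sectorObsCerts_four_N14_U8 (X := stagStructureFour)
    preservesSectors_stagStructureFour hup hψ hψ1 h₈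
  linarith

/-- **R2 row C1AF — the staggered structure factor `S(π,π) = ⟨𝓢⟩/16 ∈ [0.2087516, 3.0493982]`** (outward
7 dp; the lead's displayed edges, 2026-08-20T20:00:06Z). TYPED CLAIMS, UNSIGNED until 'ref-secrows1-replay';
WEAK (`4 × 4` is ED-able). HONEST FRAMING: ladder R1–R4 with certified numbers; no claim on H/H₀.
[cite: HirschPRB1985, eq. (4.7)] [cite: WangEtAl2024, §3 eq. (obsopt)] -/
theorem stagStructureFactor_four_N14_U8_mem_Icc_of_claims {ψ : Fock (Orb (FermionTorus 2 4))}
    (hψ : IsGroundState (hamiltonian (fermionTorusGraph 2 4) 1 8) 14 ψ) (hψ1 : star ψ ⬝ᵥ ψ = 1)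
    (h₈ : torusUpper_mbbootE2_4x4_U8_N14) (hlo : secrowsAFlo_engA_4x4_U8_N14)
    (hup : secrowsAFup_engA_4x4_U8_N14) :
    (expect stagStructureFour ψ).re / 16 ∈ Set.Icc (0.2087516 : ℝ) 3.0493982 := by
  obtain ⟨h1, h2⟩ := re_expect_stagStructureFour_N14_U8_mem_Icc_of_claims hψ hψ1 h₈ hlo hup
  constructor
  · rw [le_div_iff₀ (by norm_num : (0 : ℝ) < 16)]
    exact le_trans (by norm_num) h1
  · rw [div_le_iff₀ (by norm_num : (0 : ℝ) < 16)]
    exact le_trans h2 (by norm_num)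

/-- **R2 row C1AF — the squared staggered magnetisation `m_s² = ⟨𝓢⟩/256 ∈ [0.0130469, 0.1905874]`**
(outward 7 dp; replaces the certificate-free `m_s² ∈ [0, 35/128]` of `stagMagSq_four_N14_le` for ground states).
TYPED CLAIMS, UNSIGNED until 'ref-secrows1-replay'; WEAK. HONEST FRAMING: ladder R1–R4 with certified numbers;
no claim on H/H₀. [cite: HirschPRB1985, eq. (4.7)] [cite: WangEtAl2024, §3 eq. (obsopt)] -/
theorem stagMagSq_four_N14_U8_mem_Icc_of_claims {ψ : Fock (Orb (FermionTorus 2 4))}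
    (hψ : IsGroundState (hamiltonian (fermionTorusGraph 2 4) 1 8) 14 ψ) (hψ1 : star ψ ⬝ᵥ ψ = 1)
    (h₈ : torusUpper_mbbootE2_4x4_U8_N14) (hlo : secrowsAFlo_engA_4x4_U8_N14)
    (hup : secrowsAFup_engA_4x4_U8_N14) :
    (expect stagStructureFour ψ).re / 256 ∈ Set.Icc (0.0130469 : ℝ) 0.1905874 := by
  obtain ⟨h1, h2⟩ := re_expect_stagStructureFour_N14_U8_mem_Icc_of_claims hψ hψ1 h₈ hlo hup
  constructor
  · rw [le_div_iff₀ (by norm_num : (0 : ℝ) < 256)]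
    exact le_trans (by norm_num) h1
  · rw [div_le_iff₀ (by norm_num : (0 : ℝ) < 256)]
    exact le_trans h2 (by norm_num)

/-- The on-site part of `𝓢`: `𝓢 = Σ_{x ≠ y} ε_x ε_y 𝐒_x·𝐒_y + ¾ M` with `M = localMomentFour`
(`𝐒_x·𝐒_x = ¾ m_x`, `ε_x² = 1`). [cite: HirschPRB1985, Table II] -/
theorem stagStructureFour_eq_offsite_add :
    stagStructureFour =
      (∑ x : FermionTorus 2 4, ∑ y ∈ Finset.univ.erase x,
          (stagSign evenSitesFour x * stagSign evenSitesFour y) • fermionSpinDot x y) +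
        (3 / 4 : ℂ) • localMomentFour := by
  rw [stagStructureFour, stagSpinStructure, localMomentFour, Finset.smul_sum, ← Finset.sum_add_distrib]
  refine Finset.sum_congr rfl fun x _ => ?_
  have hε : stagSign evenSitesFour x * stagSign evenSitesFour x = 1 := by
    unfold stagSign; split_ifs <;> norm_num
  rw [← Finset.add_sum_erase _ _ (Finset.mem_univ x), hε, one_smul, fermionSpinDot_self, add_comm]

/-- **R2 row C1AF′ — the OFF-SITE staggered spin correlation per site,
`Σ_{x ≠ y} ε_x ε_y ⟨𝐒_x·𝐒_y⟩/16 ∈ [−0.4474984, 2.5044482]`** (`= (⟨𝓢⟩ − ¾(14 − 2⟨D⟩))/16`, with the D21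
row `⟨D⟩/16 ∈ [0, 0.0742]`; outward 7 dp). TYPED CLAIMS, UNSIGNED; WEAK. HONEST FRAMING: ladder R1–R4 with
certified numbers; no claim on H/H₀. [cite: HirschPRB1985, Table II] [cite: WangEtAl2024, §3 eq. (obsopt)] -/
theorem offsiteStagCorr_four_N14_U8_mem_Icc_of_claims {ψ : Fock (Orb (FermionTorus 2 4))}
    (hψ : IsGroundState (hamiltonian (fermionTorusGraph 2 4) 1 8) 14 ψ) (hψ1 : star ψ ⬝ᵥ ψ = 1)
    (h₄ : torusLower_mbboot_4x4_U4_N14) (h₈ : torusUpper_mbbootE2_4x4_U8_N14)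
    (hlo : secrowsAFlo_engA_4x4_U8_N14) (hup : secrowsAFup_engA_4x4_U8_N14) :
    (expect (∑ x : FermionTorus 2 4, ∑ y ∈ Finset.univ.erase x,
        (stagSign evenSitesFour x * stagSign evenSitesFour y) • fermionSpinDot x y) ψ).re / 16 ∈
      Set.Icc (-0.4474984 : ℝ) 2.5044482 := by
  obtain ⟨h1, h2⟩ := re_expect_stagStructureFour_N14_U8_mem_Icc_of_claims hψ hψ1 h₈ hlo hup
  obtain ⟨hd1, hd2⟩ := doubleOcc_four_N14_U8_mem_Icc_of_claims hψ hψ1 h₄ h₈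
  have hM := re_expect_localMomentFour hψ.1 hψ1
  have hsplit : (expect stagStructureFour ψ).re =
      (expect (∑ x : FermionTorus 2 4, ∑ y ∈ Finset.univ.erase x,
          (stagSign evenSitesFour x * stagSign evenSitesFour y) • fermionSpinDot x y) ψ).re +
        3 / 4 * (expect localMomentFour ψ).re := by
    rw [stagStructureFour_eq_offsite_add, expect, add_mulVec, dotProduct_add, Complex.add_re, smul_mulVec,
      dotProduct_smul, smul_eq_mul, Complex.mul_re]
    unfold expect
    norm_num
  rw [hM] at hsplit
  push_cast at hsplit hd1 hd2
  constructor
  · rw [le_div_iff₀ (by norm_num : (0 : ℝ) < 16)]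
    linarith
  · rw [div_le_iff₀ (by norm_num : (0 : ℝ) < 16)]
    linarith

end FourByFour

end Summit.HubbardSuperconductivity.HubbardLadder

end
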